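import Literature.Computability.Cryptography.LWERoundingBridges
import Literature.Computability.Cryptography.LWEPrimePowerSmoothing
import HarnessLib

/-!
# A machine sampler for the discretized Gaussian `Ψ̄_Q(β)`: round a scaled pseudo-Gaussian integer, and its statistical distance

Topic `Computability/Cryptography` (LWE), grouping namespace `BLPRS2013`. The h₃ machine of `BLPRSReduction.lean` (pqc.S21) must itself draw LWE noise
`Ψ̄_Q(β)` (BLPRS 2013, Thm. 4.1 proof and §5: the self-generated samples of the selection stage, and the fresh noise of the raising step `raiseThen`):
`Ψ̄_Q(β)` is `⌊Q·X⌉ mod Q`, `X ← 𝒩(0, β²/2π)` (Regev 2009, §2), i.e. `⌊κ·g⌉ mod Q` with `κ = Qβ/√π`, `g ← 𝒩(0, ½)`. The machine draws an integer `G` from the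
tree's pseudo-Gaussian sampler (`PGParams.lawPMF ≈ gaussBoxPMF b`, the law of `round(2ᵇg)`) and outputs `⌊κ̂·G/2ᵇ⌉ mod Q` with a RATIONAL `κ̂ ≈ κ`; no jitter is
available here (unlike the kernel's rounding step of `LWERoundingApprox.lean`), so the rare event "`κg` lies near a half-integer" is controlled instead by the
SMOOTHING bound for the discretized Gaussian at an auxiliary modulus (`LWEPrimePowerSmoothing.discretizedGaussian_ge_and_le`). Everything PROVED; definitions with
bodies; no named fact:

* `psiValue κ̂ b G = ⌊κ̂G/2ᵇ⌉`, `psiLaw Q κ̂ b ℓ` (the machine's law from an integer sampler `ℓ`), `psiIdeal`, `psiMach` (the coupled maps of `g`),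
  `discretizedGaussian_eq_toPMF_map_psiIdeal` (`Ψ̄_Q(β)` is the law of `⌊κg⌉ mod Q`), `psiLaw_gaussBoxPMF_eq`;
* `tvDist_psiLaw_le_add_measureReal_ne` (`Δ ≤ Δ(ℓ, gaussBoxPMF b) + Pr[psiMach ≠ psiIdeal]`), `setOf_psiMach_ne_subset` (failure ⇒ `|g| > T` or `κg` within
  `δ_T = |κ̂|/2^{b+1} + |κ̂−κ|·T` of a half-integer), `measureReal_abs_gt_le` (`≤ 2e^{−T²}`), **`measureReal_near_halfInt_le`** (`≤ (2Mδ+2)·((1+ε)/(1−ε))/M` for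
  every auxiliary modulus `M`, when `η_ε(ℤ) ≤ Qβ`);
* **`tvDist_psiLaw_discretizedGaussian_le`** (the assembled bound) and **`tvDist_psiLaw_std_le`** (with the tree's sampler `PGParams.std m b`: `+ 8·2^{−m}`).

## References

* Z. Brakerski, A. Langlois, C. Peikert, O. Regev, D. Stehlé, *Classical hardness of learning with errors*, STOC 2013; arXiv:1306.0281, Thm. 4.1 (proof)
  and §5. [BrakerskiEtAl2013]
* O. Regev, *On lattices, learning with errors …*, J. ACM 56 (2009), §2 (`Ψ̄_α`). [RegevLWE2009]
* C. Peikert, *Public-key cryptosystems from the worst-case shortest vector problem*, STOC 2009, p. 7 ("a suitable amount of precision"). [Peikert2009]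
* D. Micciancio, C. Peikert, *Trapdoors for lattices*, EUROCRYPT 2012, Thm. 3.1 proof (p. 15) (discretized Gaussian above smoothing is near-uniform). [MicciancioPeikert2012]
* O. Goldreich, *Foundations of Cryptography I*, CUP 2001, §3.2.1 (coupling; processing). [Goldreich2001]
-/

noncomputable section

open MeasureTheory ProbabilityTheory Real Literature.Algebra.EuclideanLattices Literature.Probability.Distributions
open scoped ENNReal NNReal

namespace Literature.Computability.Cryptography

namespace BLPRS2013

open LWE LWE.MP12

/-! ### The maps and the laws -/

section Defs

variable (Q : ℕ) [NeZero Q]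

/-- **The machine's value** `⌊κ̂·G/2ᵇ⌉` from the sampler's integer `G` (exact rational arithmetic for `κ̂ ∈ ℚ`). [cite: Peikert2009, p. 7] -/
def psiValue (κh : ℝ) (b : ℕ) (G : ℤ) : ℤ := round (κh * (G : ℝ) / 2 ^ b)

/-- **The machine's law** from an integer sampler `ℓ`: `⌊κ̂G/2ᵇ⌉ mod Q`, `G ← ℓ`. [cite: BrakerskiEtAl2013, §5; Peikert2009, p. 7] -/
def psiLaw (κh : ℝ) (b : ℕ) (ℓ : PMF ℤ) : PMF (ZMod Q) := ℓ.map fun G => ((psiValue κh b G : ℤ) : ZMod Q)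

/-- The ideal map `g ↦ ⌊κg⌉ mod Q`. [cite: RegevLWE2009, §2] -/
def psiIdeal (κ : ℝ) (g : ℝ) : ZMod Q := ((round (κ * g) : ℤ) : ZMod Q)

/-- The machine's map `g ↦ ⌊κ̂·round(2ᵇg)/2ᵇ⌉ mod Q`, coupled to the ideal one through `g`. [cite: Peikert2009, p. 7] -/
def psiMach (κh : ℝ) (b : ℕ) (g : ℝ) : ZMod Q := ((psiValue κh b (round ((2 : ℝ) ^ b * g)) : ℤ) : ZMod Q)

/-- `round` is measurable (private copy of the tree's lemma). [folklore] -/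
private theorem measurable_round'' : Measurable (round : ℝ → ℤ) := by
  have : (round : ℝ → ℤ) = fun x => ⌊x + 1 / 2⌋ := funext round_eq
  rw [this]
  exact Int.measurable_floor.comp (measurable_id.add_const _)

omit [NeZero Q] in
/-- The ideal map is measurable. [folklore] -/
theorem measurable_psiIdeal (κ : ℝ) : Measurable (psiIdeal Q κ) :=
  (measurable_from_top (f := fun z : ℤ => (z : ZMod Q))).comp (measurable_round''.comp (measurable_id.const_mul κ))

omit [NeZero Q] in
/-- The machine's map is measurable. [folklore] -/
theorem measurable_psiMach (κh : ℝ) (b : ℕ) : Measurable (psiMach Q κh b) :=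
  (measurable_from_top (f := fun G : ℤ => ((psiValue κh b G : ℤ) : ZMod Q))).comp (measurable_round_two_pow_mul b)

/-- The push-forward along the ideal map is a probability measure. [folklore] -/
instance isProbabilityMeasure_map_psiIdeal (κ : ℝ) : IsProbabilityMeasure ((gaussianReal 0 (1 / 2 : ℝ≥0)).map (psiIdeal Q κ)) :=
  Measure.isProbabilityMeasure_map (measurable_psiIdeal Q κ).aemeasurable

/-- The push-forward along the machine's map is a probability measure. [folklore] -/
instance isProbabilityMeasure_map_psiMach (κh : ℝ) (b : ℕ) : IsProbabilityMeasure ((gaussianReal 0 (1 / 2 : ℝ≥0)).map (psiMach Q κh b)) :=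
  Measure.isProbabilityMeasure_map (measurable_psiMach Q κh b).aemeasurable

/-- **`Ψ̄_Q(β)` is the law of `⌊κg⌉ mod Q`**, `κ = Qβ/√π`, `g ← 𝒩(0, ½)` (`X = (β/√π)·g` has variance `β²/2π`). [cite: RegevLWE2009, §2] -/
theorem discretizedGaussian_eq_toPMF_map_psiIdeal (β : ℝ) :
    discretizedGaussian Q β = ((gaussianReal 0 (1 / 2 : ℝ≥0)).map (psiIdeal Q ((Q : ℝ) * β / √π))).toPMF := by
  apply PMF.toMeasure_injective
  rw [Measure.toPMF_toMeasure, discretizedGaussian, Measure.toPMF_toMeasure]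
  have hfac : psiIdeal Q ((Q : ℝ) * β / √π) = discretize Q ∘ fun g : ℝ => β / √π * g := by
    funext g
    simp only [Function.comp_apply, psiIdeal, discretize]
    congr 2
    ring
  have hmeas : Measurable (fun g : ℝ => β / √π * g) := measurable_id.const_mul _
  rw [hfac, ← Measure.map_map (measurable_discretize Q) hmeas, gaussianReal_map_const_mul, mul_zero]
  congr 2
  apply NNReal.eq
  rw [Real.coe_toNNReal _ (by positivity), NNReal.coe_mul]
  change β ^ 2 / (2 * Real.pi) = (β / √π) ^ 2 * ((1 / 2 : ℝ≥0) : ℝ)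
  rw [div_pow, Real.sq_sqrt Real.pi_pos.le]
  push_cast
  ring

/-- **With the rounded Gaussian the machine's law is the push-forward of `psiMach`.** [folklore] -/
theorem psiLaw_gaussBoxPMF_eq (κh : ℝ) (b : ℕ) :
    psiLaw Q κh b (gaussBoxPMF b) = ((gaussianReal 0 (1 / 2 : ℝ≥0)).map (psiMach Q κh b)).toPMF := by
  apply PMF.toMeasure_injective
  rw [Measure.toPMF_toMeasure, psiLaw, ← PMF.toMeasure_map _ _ measurable_from_top, gaussBoxPMF, Measure.toPMF_toMeasure, gaussBoxMeasure,
    Measure.map_map measurable_from_top (measurable_round_two_pow_mul b)]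
  rfl

end Defs

/-! ### The distance: coupling, and the failure event -/

section Distance

variable (Q : ℕ) [NeZero Q]

/-- **`Δ(psiLaw ℓ, Ψ̄_Q(β)) ≤ Δ(ℓ, gaussBoxPMF b) + Pr_g[psiMach ≠ psiIdeal]`** (processing, then coupling through `g`).
[cite: Goldreich2001, §3.2.1] -/
theorem tvDist_psiLaw_le_add_measureReal_ne (κh β : ℝ) (b : ℕ) (ℓ : PMF ℤ) :
    (psiLaw Q κh b ℓ).tvDist (discretizedGaussian Q β) ≤
      ℓ.tvDist (gaussBoxPMF b) + (gaussianReal 0 (1 / 2 : ℝ≥0)).real {g | psiMach Q κh b g ≠ psiIdeal Q ((Q : ℝ) * β / √π) g} := by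
  refine (PMF.tvDist_triangle_holds _ (psiLaw Q κh b (gaussBoxPMF b)) _).trans (add_le_add ?_ ?_)
  · exact PMF.tvDist_map_le_holds _ _ _
  · rw [psiLaw_gaussBoxPMF_eq, discretizedGaussian_eq_toPMF_map_psiIdeal]
    exact tvDist_toPMF_map_le_measureReal_ne _ (measurable_psiMach Q κh b) (measurable_psiIdeal Q _)

/-- `|g - round(2ᵇg)/2ᵇ| ≤ 2^{-(b+1)}` (private copy of the tree's lemma). [folklore] -/
private theorem abs_sub_round_div_le' (b : ℕ) (g : ℝ) : |g - ((round ((2 : ℝ) ^ b * g) : ℤ) : ℝ) / 2 ^ b| ≤ 1 / 2 ^ (b + 1) := by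
  have hN : (0 : ℝ) < (2 : ℝ) ^ b := by positivity
  have h := abs_sub_round ((2 : ℝ) ^ b * g)
  have : g - ((round ((2 : ℝ) ^ b * g) : ℤ) : ℝ) / 2 ^ b = ((2 : ℝ) ^ b * g - (round ((2 : ℝ) ^ b * g) : ℤ)) / 2 ^ b := by
    field_simp
  rw [this, abs_div, abs_of_pos hN, pow_succ, one_div, mul_inv, ← one_div ((2 : ℝ) ^ b), ← one_div (2 : ℝ)]
  rw [div_le_iff₀ hN]
  calc |(2 : ℝ) ^ b * g - (round ((2 : ℝ) ^ b * g) : ℤ)| ≤ 1 / 2 := h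
    _ = 1 / 2 ^ b * (1 / 2) * 2 ^ b := by field_simp

omit [NeZero Q] in
/-- **Failure forces a large `g` or a near-half-integer**: if `psiMach g ≠ psiIdeal g` and `|g| ≤ T` then `κg` is within
`δ_T = |κ̂|/2^{b+1} + |κ̂ − κ|·T` of a half-integer. [cite: Peikert2009, p. 7] -/
theorem setOf_psiMach_ne_subset (κ κh : ℝ) (b : ℕ) (T : ℝ) :
    {g | psiMach Q κh b g ≠ psiIdeal Q κ g} ⊆
      {g | T < |g|} ∪ {g | ∃ m : ℤ, |κ * g - ((m : ℝ) + 1 / 2)| ≤ |κh| / 2 ^ (b + 1) + |κh - κ| * T} := by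
  intro g hg
  by_cases hgT : T < |g|
  · exact Or.inl hgT
  · right
    rw [not_lt] at hgT
    have hne : round (κ * g) ≠ round (κh * ((round ((2 : ℝ) ^ b * g) : ℤ) : ℝ) / 2 ^ b) := by
      intro heq
      exact hg (by simp only [psiMach, psiIdeal, psiValue]; rw [heq])
    obtain ⟨m, hm⟩ := exists_abs_sub_half_le_of_round_ne hne
    refine ⟨m, hm.trans ?_⟩
    have h1 := abs_sub_round_div_le' b g
    have hsplit : κ * g - κh * ((round ((2 : ℝ) ^ b * g) : ℤ) : ℝ) / 2 ^ b =
        κh * (g - ((round ((2 : ℝ) ^ b * g) : ℤ) : ℝ) / 2 ^ b) + (κ - κh) * g := by ring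
    rw [hsplit]
    calc |κh * (g - ((round ((2 : ℝ) ^ b * g) : ℤ) : ℝ) / 2 ^ b) + (κ - κh) * g|
        ≤ |κh * (g - ((round ((2 : ℝ) ^ b * g) : ℤ) : ℝ) / 2 ^ b)| + |(κ - κh) * g| := abs_add_le _ _
      _ = |κh| * |g - ((round ((2 : ℝ) ^ b * g) : ℤ) : ℝ) / 2 ^ b| + |κh - κ| * |g| := by
          rw [abs_mul, abs_mul, abs_sub_comm κ κh]
      _ ≤ |κh| * (1 / 2 ^ (b + 1)) + |κh - κ| * T := by
          gcongr
      _ = |κh| / 2 ^ (b + 1) + |κh - κ| * T := by ring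

/-- **The Gaussian tail**: `Pr[|g| > T] ≤ 2e^{−T²}` for `g ← 𝒩(0, ½)`, `T ≥ 0`. [folklore] -/
theorem measureReal_abs_gt_le {T : ℝ} (hT : 0 ≤ T) : (gaussianReal 0 (1 / 2 : ℝ≥0)).real {g : ℝ | T < |g|} ≤ 2 * exp (-T ^ 2) := by
  have hsub : {g : ℝ | T < |g|} ⊆ {x : ℝ | T ≤ x} ∪ {x : ℝ | x ≤ -T} := by
    intro g hg
    simp only [Set.mem_setOf_eq] at hg
    rcases le_or_gt 0 g with h0 | h0
    · left; rw [abs_of_nonneg h0] at hg; exact hg.le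
    · right; rw [abs_of_neg h0] at hg; show g ≤ -T; linarith
  calc (gaussianReal 0 (1 / 2 : ℝ≥0)).real {g : ℝ | T < |g|}
      ≤ (gaussianReal 0 (1 / 2 : ℝ≥0)).real ({x : ℝ | T ≤ x} ∪ {x : ℝ | x ≤ -T}) := measureReal_mono hsub
    _ ≤ (gaussianReal 0 (1 / 2 : ℝ≥0)).real {x : ℝ | T ≤ x} + (gaussianReal 0 (1 / 2 : ℝ≥0)).real {x : ℝ | x ≤ -T} := measureReal_union_le _ _
    _ ≤ exp (-T ^ 2) + exp (-T ^ 2) := add_le_add (gaussianReal_half_real_Ici_le hT) (gaussianReal_half_real_Iic_le hT)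
    _ = 2 * exp (-T ^ 2) := by ring

/-- **`κg` is rarely near a half-integer** when `κ√π` exceeds the smoothing parameter of `ℤ`: for every auxiliary modulus `M ≥ 1`,
`Pr[∃ m, |κg − (m+½)| ≤ δ] ≤ (2Mδ + 2)·((1+ε)/(1−ε))/M` — scale by `M`, round: the residue of `⌊Mκg⌉ mod M` falls in a window of at most `2Mδ + 2` classes,
and `⌊Mκg⌉ mod M ~ Ψ̄_M(κ√π)` puts mass `≤ ((1+ε)/(1−ε))/M` on each class. [cite: MicciancioPeikert2012, Thm. 3.1 proof (p. 15); RegevLWE2009, §2] -/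
theorem measureReal_near_halfInt_le {κ : ℝ} (hκ : 0 < κ) {δ ε : ℝ} (hδ : 0 ≤ δ) (hε : 0 < ε) (hε1 : ε < 1)
    (hsm : smoothingParameter intLattice ε ≤ κ * √π) (M : ℕ) [NeZero M] :
    (gaussianReal 0 (1 / 2 : ℝ≥0)).real {g : ℝ | ∃ m : ℤ, |κ * g - ((m : ℝ) + 1 / 2)| ≤ δ} ≤
      (2 * M * δ + 2) * ((1 + ε) / (1 - ε)) / M := by
  classical
  have hMpos : (0 : ℝ) < M := by exact_mod_cast Nat.pos_of_ne_zero (NeZero.ne M)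
  have hκpos : 0 < κ * √π := mul_pos hκ (Real.sqrt_pos.2 Real.pi_pos)
  have h1ε : 0 < 1 - ε := by linarith
  have hC : 0 ≤ (1 + ε) / (1 - ε) := div_nonneg (by linarith) h1ε.le
  -- the residue map and its law
  set F : ℝ → ZMod M := psiIdeal M ((M : ℝ) * κ) with hF
  have hlaw : ((gaussianReal 0 (1 / 2 : ℝ≥0)).map F) = (discretizedGaussian M (κ * √π)).toMeasure := by
    rw [discretizedGaussian_eq_toPMF_map_psiIdeal, Measure.toPMF_toMeasure, hF]
    congr 2
    rw [eq_div_iff (Real.sqrt_ne_zero'.2 Real.pi_pos)]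
    ring
  -- the window of integers and of residues
  set lo : ℤ := ⌈(M : ℝ) / 2 - (M * δ + 1 / 2)⌉ with hlo
  set hi : ℤ := ⌊(M : ℝ) / 2 + (M * δ + 1 / 2)⌋ with hhi
  set J : Finset ℤ := Finset.Icc lo hi with hJ
  set W : Finset (ZMod M) := J.image (fun k : ℤ => (k : ZMod M)) with hW
  -- the event lies in the preimage of the window
  have hsub : {g : ℝ | ∃ m : ℤ, |κ * g - ((m : ℝ) + 1 / 2)| ≤ δ} ⊆ F ⁻¹' (↑W : Set (ZMod M)) := by
    rintro g ⟨m, hm⟩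
    simp only [Set.mem_preimage, Finset.coe_image, Set.mem_image, Finset.mem_coe, hW, hJ, Finset.mem_Icc]
    refine ⟨round ((M : ℝ) * κ * g) - M * m, ⟨?_, ?_⟩, ?_⟩
    · -- lower end
      rw [hlo, Int.ceil_le]
      have h1 := abs_sub_round ((M : ℝ) * κ * g)
      have h2 : |(M : ℝ) * κ * g - ((M : ℝ) * m + M / 2)| ≤ M * δ := by
        have : (M : ℝ) * κ * g - ((M : ℝ) * m + M / 2) = M * (κ * g - ((m : ℝ) + 1 / 2)) := by ring
        rw [this, abs_mul, abs_of_pos hMpos]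
        exact mul_le_mul_of_nonneg_left hm hMpos.le
      push_cast
      rw [abs_le] at h1 h2
      linarith [h1.1, h2.1]
    · rw [hhi, Int.le_floor]
      have h1 := abs_sub_round ((M : ℝ) * κ * g)
      have h2 : |(M : ℝ) * κ * g - ((M : ℝ) * m + M / 2)| ≤ M * δ := by
        have : (M : ℝ) * κ * g - ((M : ℝ) * m + M / 2) = M * (κ * g - ((m : ℝ) + 1 / 2)) := by ring
        rw [this, abs_mul, abs_of_pos hMpos]
        exact mul_le_mul_of_nonneg_left hm hMpos.le
      push_cast
      rw [abs_le] at h1 h2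
      linarith [h1.2, h2.2]
    · simp only [hF, psiIdeal]
      push_cast
      simp
  -- the size of the window
  have hcardJ : (J.card : ℝ) ≤ 2 * M * δ + 2 := by
    rw [hJ, Int.card_Icc]
    have hlen : ((hi + 1 - lo).toNat : ℝ) ≤ 2 * M * δ + 2 := by
      rcases le_or_gt 0 (hi + 1 - lo) with h0 | h0
      · have : ((hi + 1 - lo).toNat : ℤ) = hi + 1 - lo := Int.toNat_of_nonneg h0
        have hcast : ((hi + 1 - lo).toNat : ℝ) = (hi : ℝ) + 1 - lo := by exact_mod_cast this
        rw [hcast]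
        have hhi' : (hi : ℝ) ≤ (M : ℝ) / 2 + (M * δ + 1 / 2) := Int.floor_le _
        have hlo' : (M : ℝ) / 2 - (M * δ + 1 / 2) ≤ lo := Int.le_ceil _
        linarith
      · have : (hi + 1 - lo).toNat = 0 := Int.toNat_eq_zero.2 h0.le
        rw [this]; push_cast; positivity
    exact hlen
  have hcardW : (W.card : ℝ) ≤ 2 * M * δ + 2 := (Nat.cast_le.2 Finset.card_image_le).trans hcardJ
  -- the mass of each class
  have hpt : ∀ w : ZMod M, (discretizedGaussian M (κ * √π) w).toReal ≤ (1 + ε) / (1 - ε) * (1 / M) := by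
    intro w
    have h := (discretizedGaussian_ge_and_le M hε hε1 hκpos hsm w).2
    have hfin : ENNReal.ofReal ((1 + ε) / (1 - ε)) * ENNReal.ofReal (1 / (M : ℝ)) ≠ ⊤ := ENNReal.mul_ne_top ENNReal.ofReal_ne_top ENNReal.ofReal_ne_top
    have := ENNReal.toReal_mono hfin h
    rwa [ENNReal.toReal_mul, ENNReal.toReal_ofReal hC, ENNReal.toReal_ofReal (by positivity)] at this
  -- assemble
  calc (gaussianReal 0 (1 / 2 : ℝ≥0)).real {g : ℝ | ∃ m : ℤ, |κ * g - ((m : ℝ) + 1 / 2)| ≤ δ}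
      ≤ (gaussianReal 0 (1 / 2 : ℝ≥0)).real (F ⁻¹' (↑W : Set (ZMod M))) := measureReal_mono hsub
    _ = ((discretizedGaussian M (κ * √π)).toMeasure (↑W : Set (ZMod M))).toReal := by
        rw [measureReal_def, ← Measure.map_apply (measurable_psiIdeal M _) W.measurableSet, hlaw]
    _ = ∑ w ∈ W, (discretizedGaussian M (κ * √π) w).toReal := by
        rw [PMF.toMeasure_apply_finset, ENNReal.toReal_sum (fun w _ => PMF.apply_ne_top _ _)]
    _ ≤ ∑ _w ∈ W, (1 + ε) / (1 - ε) * (1 / M) := Finset.sum_le_sum fun w _ => hpt w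
    _ = W.card * ((1 + ε) / (1 - ε) * (1 / M)) := by rw [Finset.sum_const, nsmul_eq_mul]
    _ ≤ (2 * M * δ + 2) * ((1 + ε) / (1 - ε) * (1 / M)) :=
        mul_le_mul_of_nonneg_right hcardW (mul_nonneg hC (by positivity))
    _ = (2 * M * δ + 2) * ((1 + ε) / (1 - ε)) / M := by ring

/-- **The machine's discretized Gaussian is close to `Ψ̄_Q(β)`**: for every `T ≥ 0`, `0 < ε < 1` with `η_ε(ℤ) ≤ Qβ`, and auxiliary modulus `M`,
`Δ(psiLaw κ̂ b ℓ, Ψ̄_Q(β)) ≤ Δ(ℓ, gaussBoxPMF b) + 2e^{−T²} + (2Mδ_T + 2)((1+ε)/(1−ε))/M`, `δ_T = |κ̂|/2^{b+1} + |κ̂ − Qβ/√π|·T`.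
[cite: BrakerskiEtAl2013, §5; Peikert2009, p. 7; MicciancioPeikert2012, Thm. 3.1 proof (p. 15)] -/
theorem tvDist_psiLaw_discretizedGaussian_le (κh : ℝ) {β : ℝ} (hβ : 0 < β) (b : ℕ) (ℓ : PMF ℤ) {T ε : ℝ} (hT : 0 ≤ T) (hε : 0 < ε) (hε1 : ε < 1)
    (hsm : smoothingParameter intLattice ε ≤ (Q : ℝ) * β) (M : ℕ) [NeZero M] :
    (psiLaw Q κh b ℓ).tvDist (discretizedGaussian Q β) ≤
      ℓ.tvDist (gaussBoxPMF b) + 2 * exp (-T ^ 2) +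
        (2 * M * (|κh| / 2 ^ (b + 1) + |κh - (Q : ℝ) * β / √π| * T) + 2) * ((1 + ε) / (1 - ε)) / M := by
  have hκ : smoothingParameter intLattice ε ≤ (Q : ℝ) * β / √π * √π := by
    rwa [div_mul_cancel₀ _ (Real.sqrt_ne_zero'.2 Real.pi_pos)]
  have hκ0 : 0 < (Q : ℝ) * β / √π := by
    have hQ : (0 : ℝ) < Q := by exact_mod_cast Nat.pos_of_ne_zero (NeZero.ne Q)
    exact div_pos (mul_pos hQ hβ) (Real.sqrt_pos.2 Real.pi_pos)
  have hδ : 0 ≤ |κh| / 2 ^ (b + 1) + |κh - (Q : ℝ) * β / √π| * T := by positivity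
  refine (tvDist_psiLaw_le_add_measureReal_ne Q κh β b ℓ).trans ?_
  rw [add_assoc]
  refine add_le_add le_rfl ?_
  calc (gaussianReal 0 (1 / 2 : ℝ≥0)).real {g | psiMach Q κh b g ≠ psiIdeal Q ((Q : ℝ) * β / √π) g}
      ≤ (gaussianReal 0 (1 / 2 : ℝ≥0)).real ({g : ℝ | T < |g|} ∪
          {g : ℝ | ∃ m : ℤ, |(Q : ℝ) * β / √π * g - ((m : ℝ) + 1 / 2)| ≤ |κh| / 2 ^ (b + 1) + |κh - (Q : ℝ) * β / √π| * T}) :=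
        measureReal_mono (setOf_psiMach_ne_subset Q _ κh b T)
    _ ≤ (gaussianReal 0 (1 / 2 : ℝ≥0)).real {g : ℝ | T < |g|} +
          (gaussianReal 0 (1 / 2 : ℝ≥0)).real {g : ℝ | ∃ m : ℤ, |(Q : ℝ) * β / √π * g - ((m : ℝ) + 1 / 2)| ≤
            |κh| / 2 ^ (b + 1) + |κh - (Q : ℝ) * β / √π| * T} := measureReal_union_le _ _
    _ ≤ 2 * exp (-T ^ 2) + (2 * M * (|κh| / 2 ^ (b + 1) + |κh - (Q : ℝ) * β / √π| * T) + 2) * ((1 + ε) / (1 - ε)) / M :=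
        add_le_add (measureReal_abs_gt_le hT) (measureReal_near_halfInt_le hκ0 hδ hε hε1 hκ M)

/-- **With the tree's pseudo-Gaussian sampler** `PGParams.std m b` (`1 ≤ m`, `m + rOf m + 1 ≤ b`): add `8·2^{−m}`. [cite: BrakerskiEtAl2013, §5; Peikert2009, p. 7] -/
theorem tvDist_psiLaw_std_le (κh : ℝ) {β : ℝ} (hβ : 0 < β) {m b : ℕ} (hm : 1 ≤ m) (hb : m + PGParams.rOf m + 1 ≤ b) {T ε : ℝ} (hT : 0 ≤ T)
    (hε : 0 < ε) (hε1 : ε < 1) (hsm : smoothingParameter intLattice ε ≤ (Q : ℝ) * β) (M : ℕ) [NeZero M] :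
    (psiLaw Q κh b (PGParams.std m b).lawPMF).tvDist (discretizedGaussian Q β) ≤
      8 * ((2 : ℝ) ^ m)⁻¹ + 2 * exp (-T ^ 2) +
        (2 * M * (|κh| / 2 ^ (b + 1) + |κh - (Q : ℝ) * β / √π| * T) + 2) * ((1 + ε) / (1 - ε)) / M := by
  refine (tvDist_psiLaw_discretizedGaussian_le Q κh hβ b _ hT hε hε1 hsm M).trans ?_
  have := PGParams.tvDist_lawPMF_std_gaussBoxPMF_le m b hm hb
  linarith

end Distance

end BLPRS2013

end Literature.Computability.Cryptography

end
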